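import Mathlib

/-!
# Volume count of an `r₀`-dense ball in `ℝ³`
# (stub `stub_coverCount`, S7 of crux `HullMinimality.LayeredWindows`, line `registered`)

Crux `HullMinimality.LayeredWindows` (item stmt-AtomisticToContinuum-11778).  If every point of
the closed ball `closedBall c R` of `ℝ³` (`0 ≤ R`) has a point of the finite set `S` at distance
`< r₀` (`0 < r₀`), then at least `(R / r₀)³` points of `S` lie within `R + r₀` of `c`.

Proof (volume comparison).  With `S' = {q ∈ S | dist q c ≤ R + r₀}` the balls `ball q r₀`,
`q ∈ S'`, cover `closedBall c R` (for `y` in the closed ball pick `q ∈ S` with `dist q y < r₀`;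
then `dist q c ≤ dist q y + dist y c < r₀ + R`).  Comparing Lebesgue measures (an additive Haar
measure on `EuclideanSpace ℝ (Fin 3)`, `finrank = 3`),
`R³ · |B₁| = |closedBall c R| ≤ ∑_{q ∈ S'} |ball q r₀| = #S' · r₀³ · |B₁|`
(`Measure.addHaar_closedBall`, `Measure.addHaar_ball_of_pos`, `measure_biUnion_finset_le`), and
`0 < |B₁| < ∞` cancels.  [folklore]
-/

noncomputable section

open scoped BigOperators Classical ENNReal
open MeasureTheory Metric

namespace Summit.AtomisticToContinuum.Crystallization.Theorems.LayeredWindowsLocal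

local notation "E3" => EuclideanSpace ℝ (Fin 3)

/-- **Covering step.** If every point of `closedBall c R` has a point of `S` at distance `< r₀`,
then the balls `ball q r₀` about the points `q ∈ S` with `dist q c ≤ R + r₀` cover
`closedBall c R`. -/
theorem closedBall_subset_biUnion_ball_filter (r₀ R : ℝ) (c : E3) (S : Finset E3)
    (hcov : ∀ y : E3, dist y c ≤ R → ∃ q ∈ S, dist q y < r₀) :
    closedBall c R ⊆ ⋃ q ∈ (S.filter fun q => dist q c ≤ R + r₀), ball q r₀ := by
  intro y hy
  rw [mem_closedBall] at hy
  obtain ⟨q, hqS, hqy⟩ := hcov y hy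
  have hq' : q ∈ S.filter fun q => dist q c ≤ R + r₀ := by
    rw [Finset.mem_filter]
    refine ⟨hqS, ?_⟩
    have := dist_triangle q y c
    linarith
  refine Set.mem_iUnion₂.2 ⟨q, hq', ?_⟩
  rw [mem_ball, dist_comm]
  exact hqy

/-- **Volume count (ENNReal form).** Under the covering hypothesis,
`R³ ≤ #S' · r₀³` as extended nonnegative reals, `S' = {q ∈ S | dist q c ≤ R + r₀}`:
compare the Lebesgue measures of `closedBall c R` and of the covering balls and cancel the
(positive, finite) volume of the unit ball. -/
theorem ofReal_pow_le_card_mul (r₀ R : ℝ) (hr₀ : 0 < r₀) (hR : 0 ≤ R) (c : E3) (S : Finset E3)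
    (hcov : ∀ y : E3, dist y c ≤ R → ∃ q ∈ S, dist q y < r₀) :
    ENNReal.ofReal (R ^ 3) ≤
      ((S.filter fun q => dist q c ≤ R + r₀).card : ℝ≥0∞) * ENNReal.ofReal (r₀ ^ 3) := by
  set S' := S.filter fun q => dist q c ≤ R + r₀ with hS'
  let μ : Measure E3 := volume
  have hn : Module.finrank ℝ E3 = 3 := finrank_euclideanSpace_fin
  have hsub : closedBall c R ⊆ ⋃ q ∈ S', ball q r₀ :=
    closedBall_subset_biUnion_ball_filter r₀ R c S hcov
  have hB₁pos : μ (ball (0 : E3) 1) ≠ 0 := (measure_ball_pos _ _ zero_lt_one).ne'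
  have hB₁top : μ (ball (0 : E3) 1) ≠ ⊤ := measure_ball_lt_top.ne
  have I : ENNReal.ofReal (R ^ 3) * μ (ball 0 1) ≤
      (S'.card : ℝ≥0∞) * ENNReal.ofReal (r₀ ^ 3) * μ (ball 0 1) := by
    calc ENNReal.ofReal (R ^ 3) * μ (ball 0 1) = μ (closedBall c R) := by
          rw [μ.addHaar_closedBall c hR, hn]
      _ ≤ μ (⋃ q ∈ S', ball q r₀) := measure_mono hsub
      _ ≤ ∑ q ∈ S', μ (ball q r₀) := measure_biUnion_finset_le S' _
      _ = (S'.card : ℝ≥0∞) * ENNReal.ofReal (r₀ ^ 3) * μ (ball 0 1) := by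
          simp only [μ.addHaar_ball_of_pos _ hr₀, hn, Finset.sum_const, nsmul_eq_mul, mul_assoc]
  exact (ENNReal.mul_le_mul_iff_left hB₁pos hB₁top).1 I

/-- **Stub S7 `stub_coverCount` (volume count).** If every point of the closed ball `B(c, R)` has
a point of the finite set `S` within `r₀`, then at least `(R/r₀)³` points of `S` lie within
`R + r₀` of `c` (the balls `B(q, r₀)` cover `B(c, R)`; compare Lebesgue measures). -/
theorem stub_coverCount :
    ∀ (r₀ R : ℝ), 0 < r₀ → 0 ≤ R → ∀ (c : E3) (S : Finset E3), (∀ y : E3, dist y c ≤ R → ∃ q ∈ S, dist q y < r₀) → (R / r₀) ^ 3 ≤ ((S.filter fun q => dist q c ≤ R + r₀).card : ℝ) := by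
  intro r₀ R hr₀ hR c S hcov
  have J := ofReal_pow_le_card_mul r₀ R hr₀ hR c S hcov
  have h1 : ((S.filter fun q => dist q c ≤ R + r₀).card : ℝ≥0∞) * ENNReal.ofReal (r₀ ^ 3) =
      ENNReal.ofReal (((S.filter fun q => dist q c ≤ R + r₀).card : ℝ) * r₀ ^ 3) := by
    rw [ENNReal.ofReal_mul (Nat.cast_nonneg _), ENNReal.ofReal_natCast]
  rw [h1] at J
  have K : R ^ 3 ≤ ((S.filter fun q => dist q c ≤ R + r₀).card : ℝ) * r₀ ^ 3 :=
    (ENNReal.ofReal_le_ofReal_iff (by positivity)).1 J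
  rw [div_pow, div_le_iff₀ (pow_pos hr₀ 3)]
  exact K

end Summit.AtomisticToContinuum.Crystallization.Theorems.LayeredWindowsLocal

end
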